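import Summits.QuantumFields.YangMills.Theorems.SmallCircleAnchorAnchorGapStubDebyeScreening5

/-!
# Crux `AnchorGap` (stmt-QuantumFields-11141), line `registered` — the bond-weighted Debye–Hückel operator (M-a(s) under stub X₀)

Uniform covariance decay along the decoupling interpolation.  The precision matrices
`P_bd + s (P − P_bd)` met in the Glimm–Jaffe–Spencer steps (`gaussian_decoupling_step` of
`…StubDebyeScreening20`) applied to the Debye–Hückel matrix `P = g⁻²[(−Δ_N + ε) ⊗ 1 + 1 ⊗ B]`
are Debye–Hückel operators whose hopping terms carry BOND WEIGHTS `w ∈ [0,1]` (`w = s` across the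
decoupled interface, `1` elsewhere) while the diagonal `ε + 2d` is kept:

  `(L_w u)(x) = (ε + 2d) u(x) + B u(x) − Σ_i (w(x,i) u(x+eᵢ) + w(x−eᵢ,i) u(x−eᵢ))`,

`w(x,i)` the weight of the bond `{x, x+eᵢ}`.  Killing hopping only improves diagonal dominance, so
the estimates of `…StubDebyeScreening5` hold uniformly in the weights:

* `weightedDebyeOp_coercive` — `b₀ Σ|u|² ≤ ⟨u, L_w u⟩` for `ε ≥ 0`, `B ≥ b₀`, `0 ≤ w ≤ 1`
  (bondwise `u² + v² − 2wuv ≥ 0`);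
* `weightedDebyeGreen_decay` — if `L_w u = δ_y ⊗ v` then `|u(x)|² ≤ (|v|²/b₀²)(2d/(2d+b₀))^{2n}` for
  `x_{i₀} − y_{i₀}` `n`-far, uniformly in `N`, `ε ≥ 0` and the weights (the induction of
  `debyeGreen_decay` with `|Σ_i (w u(x+eᵢ) + w' u(x−eᵢ))|² ≤ (2d)² max|u|²`).
-/

set_option autoImplicit false

noncomputable section

namespace Summit.QuantumFields.YangMills.Theorems.AnchorGap

open MeasureTheory
open Literature.Probability.LatticeModels

/-- Translation invariance of sums over the torus: `Σ_x f(x + v) = Σ_x f(x)`. -/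
private lemma sum_torus_shift {d N : ℕ} [NeZero N] (v : TorusSite d N) (f : TorusSite d N → ℝ) :
    ∑ x : TorusSite d N, f (x + v) = ∑ x : TorusSite d N, f x :=
  Fintype.sum_equiv (Equiv.addRight v) _ _ fun _ => rfl

/-- **Coercivity of the bond-weighted Debye–Hückel operator.** For `ε ≥ 0`, a mass matrix `B` with
`wᵀBw ≥ b₀|w|²` and bond weights `0 ≤ w(x,i) ≤ 1`:
`b₀ Σ_x |u(x)|² ≤ Σ_x u(x)·(L_w u)(x)` with
`(L_w u)(x) = (ε + 2d)u(x) + Bu(x) − Σ_i (w(x,i)u(x+eᵢ) + w(x−eᵢ,i)u(x−eᵢ))` — the weighted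
Laplacian part is `Σ_{bonds} [u(x)² + u(x+eᵢ)² − 2w u(x)u(x+eᵢ)] ≥ 0`. [folklore] -/
theorem weightedDebyeOp_coercive :
    ∀ (d N k : ℕ) [NeZero N] (ε b₀ : ℝ), 0 ≤ ε → ∀ (B : Fin k → Fin k → ℝ), (∀ w : Fin k → ℝ, b₀ * ∑ a : Fin k, w a ^ 2 ≤ ∑ a : Fin k, ∑ a' : Fin k, w a * B a a' * w a') → ∀ (wt : TorusSite d N → Fin d → ℝ), (∀ (x : TorusSite d N) (i : Fin d), 0 ≤ wt x i ∧ wt x i ≤ 1) → ∀ u : TorusSite d N → Fin k → ℝ, b₀ * ∑ x : TorusSite d N, ∑ a : Fin k, u x a ^ 2 ≤ ∑ x : TorusSite d N, ∑ a : Fin k, u x a * ((ε + 2 * d) * u x a + ∑ a' : Fin k, B a a' * u x a' - ∑ i : Fin d, (wt x i * u (x + Pi.single i 1) a + wt (x - Pi.single i 1) i * u (x - Pi.single i 1) a)) := by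
  intro d N k _ ε b₀ hε B hB wt hwt u
  -- the weighted Laplacian part, per component `a`
  have hlap : ∀ a : Fin k, 0 ≤ ∑ x : TorusSite d N, u x a *
      (2 * d * u x a - ∑ i : Fin d, (wt x i * u (x + Pi.single i 1) a + wt (x - Pi.single i 1) i * u (x - Pi.single i 1) a)) := by
    intro a
    -- reindex the backward hopping terms
    have hback : ∀ i : Fin d, ∑ x : TorusSite d N, u x a * (wt (x - Pi.single i 1) i * u (x - Pi.single i 1) a) =
        ∑ x : TorusSite d N, u (x + Pi.single i 1) a * (wt x i * u x a) := by
      intro i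
      exact Fintype.sum_equiv (Equiv.subRight (Pi.single i (1 : ZMod N))) _ _ fun x => by
        simp only [Equiv.subRight_apply, sub_add_cancel]
    have hdeg : ∀ i : Fin d, ∑ x : TorusSite d N, u (x + Pi.single i 1) a ^ 2 = ∑ x : TorusSite d N, u x a ^ 2 :=
      fun i => sum_torus_shift (Pi.single i 1) (fun x => u x a ^ 2)
    set U : ℝ := ∑ x : TorusSite d N, u x a ^ 2 with hU
    set Fb : Fin d → ℝ := fun i => ∑ x : TorusSite d N, wt x i * u x a * u (x + Pi.single i 1) a with hFb
    have hL : ∑ x : TorusSite d N, u x a *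
        (2 * d * u x a - ∑ i : Fin d, (wt x i * u (x + Pi.single i 1) a + wt (x - Pi.single i 1) i * u (x - Pi.single i 1) a)) =
        2 * d * U - 2 * ∑ i : Fin d, Fb i := by
      have h1 : ∑ x : TorusSite d N, u x a *
          (2 * d * u x a - ∑ i : Fin d, (wt x i * u (x + Pi.single i 1) a + wt (x - Pi.single i 1) i * u (x - Pi.single i 1) a)) =
          2 * d * U - ∑ x : TorusSite d N, ∑ i : Fin d,
            (u x a * (wt x i * u (x + Pi.single i 1) a) + u x a * (wt (x - Pi.single i 1) i * u (x - Pi.single i 1) a)) := by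
        rw [hU, Finset.mul_sum, ← Finset.sum_sub_distrib]
        refine Finset.sum_congr rfl fun x _ => ?_
        rw [mul_sub, Finset.mul_sum]
        congr 1
        · ring
        · exact Finset.sum_congr rfl fun i _ => by ring
      have h2 : ∑ x : TorusSite d N, ∑ i : Fin d,
          (u x a * (wt x i * u (x + Pi.single i 1) a) + u x a * (wt (x - Pi.single i 1) i * u (x - Pi.single i 1) a)) =
          ∑ i : Fin d, Fb i + ∑ i : Fin d, Fb i := by
        rw [Finset.sum_comm, ← Finset.sum_add_distrib]
        refine Finset.sum_congr rfl fun i _ => ?_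
        rw [Finset.sum_add_distrib, hback i, hFb]
        congr 1
        · exact Finset.sum_congr rfl fun x _ => by ring
        · exact Finset.sum_congr rfl fun x _ => by ring
      rw [h1, h2]; ring
    have hR : ∑ i : Fin d, ∑ x : TorusSite d N,
        (u x a ^ 2 + u (x + Pi.single i 1) a ^ 2 - 2 * wt x i * u x a * u (x + Pi.single i 1) a) =
        2 * d * U - 2 * ∑ i : Fin d, Fb i := by
      have h2 : ∀ i : Fin d, ∑ x : TorusSite d N,
          (u x a ^ 2 + u (x + Pi.single i 1) a ^ 2 - 2 * wt x i * u x a * u (x + Pi.single i 1) a) = 2 * U - 2 * Fb i := by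
        intro i
        rw [Finset.sum_sub_distrib, Finset.sum_add_distrib, hdeg i, ← hU]
        have : ∑ x : TorusSite d N, 2 * wt x i * u x a * u (x + Pi.single i 1) a = 2 * Fb i := by
          rw [hFb, Finset.mul_sum]
          exact Finset.sum_congr rfl fun x _ => by ring
        rw [this]; ring
      rw [Finset.sum_congr rfl fun i _ => h2 i, Finset.sum_sub_distrib, Finset.sum_const, Finset.card_univ,
        Fintype.card_fin, nsmul_eq_mul, ← Finset.mul_sum]
      ring
    have hrw : ∑ x : TorusSite d N, u x a *
        (2 * d * u x a - ∑ i : Fin d, (wt x i * u (x + Pi.single i 1) a + wt (x - Pi.single i 1) i * u (x - Pi.single i 1) a)) =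
        ∑ i : Fin d, ∑ x : TorusSite d N,
          (u x a ^ 2 + u (x + Pi.single i 1) a ^ 2 - 2 * wt x i * u x a * u (x + Pi.single i 1) a) := by
      rw [hL, hR]
    rw [hrw]
    refine Finset.sum_nonneg fun i _ => Finset.sum_nonneg fun x _ => ?_
    obtain ⟨h0, h1⟩ := hwt x i
    nlinarith [sq_nonneg (u x a - u (x + Pi.single i 1) a), sq_nonneg (u x a + u (x + Pi.single i 1) a),
      mul_nonneg h0 (sq_nonneg (u x a - u (x + Pi.single i 1) a)),
      mul_nonneg (sub_nonneg.2 h1) (sq_nonneg (u x a + u (x + Pi.single i 1) a)),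
      mul_nonneg (sub_nonneg.2 h1) (sq_nonneg (u x a - u (x + Pi.single i 1) a))]
  -- the mass part
  have hBsum : b₀ * ∑ x : TorusSite d N, ∑ a : Fin k, u x a ^ 2 ≤
      ∑ x : TorusSite d N, ∑ a : Fin k, u x a * ∑ a' : Fin k, B a a' * u x a' := by
    rw [Finset.mul_sum]
    refine Finset.sum_le_sum fun x _ => (hB (u x)).trans (le_of_eq ?_)
    refine Finset.sum_congr rfl fun a _ => ?_
    rw [Finset.mul_sum]
    exact Finset.sum_congr rfl fun a' _ => by ring
  -- the `ε` part
  have hεsum : 0 ≤ ∑ x : TorusSite d N, ∑ a : Fin k, u x a * (ε * u x a) :=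
    Finset.sum_nonneg fun x _ => Finset.sum_nonneg fun a _ => by nlinarith [sq_nonneg (u x a)]
  have hsplit : ∑ x : TorusSite d N, ∑ a : Fin k, u x a * ((ε + 2 * d) * u x a + ∑ a' : Fin k, B a a' * u x a' -
      ∑ i : Fin d, (wt x i * u (x + Pi.single i 1) a + wt (x - Pi.single i 1) i * u (x - Pi.single i 1) a)) =
      ∑ x : TorusSite d N, ∑ a : Fin k, u x a * (ε * u x a) +
      ∑ a : Fin k, ∑ x : TorusSite d N, u x a *
        (2 * d * u x a - ∑ i : Fin d, (wt x i * u (x + Pi.single i 1) a + wt (x - Pi.single i 1) i * u (x - Pi.single i 1) a)) +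
      ∑ x : TorusSite d N, ∑ a : Fin k, u x a * ∑ a' : Fin k, B a a' * u x a' := by
    rw [Finset.sum_comm (s := (Finset.univ : Finset (Fin k))), ← Finset.sum_add_distrib, ← Finset.sum_add_distrib]
    refine Finset.sum_congr rfl fun x _ => ?_
    rw [← Finset.sum_add_distrib, ← Finset.sum_add_distrib]
    exact Finset.sum_congr rfl fun a _ => by ring
  rw [hsplit]
  have := Finset.sum_nonneg fun a (_ : a ∈ (Finset.univ : Finset (Fin k))) => hlap a
  linarith

/-- **Exponential decay of the bond-weighted Debye–Hückel Green's function, uniform in the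
period and in the weights.** Let `ε ≥ 0`, `B ≥ b₀ > 0`, bond weights `0 ≤ w ≤ 1`, and
`L_w u = δ_y ⊗ v`.  If `x_{i₀} − y_{i₀} ∈ ℤ/N` is not the class of any integer of modulus `< n`, then
`|u(x)|² ≤ (|v|²/b₀²) (2d/(2d+b₀))^{2n}` (the proof of `debyeGreen_decay` verbatim: global `ℓ²`
bound from `weightedDebyeOp_coercive`, then induction on `n` through the local equation, using
`|Σ_i (w u(x+eᵢ) + w' u(x−eᵢ))|² ≤ (2d)² max|u|²` for weights in `[0,1]`).  This is the covariance
decay needed UNIFORMLY along the decoupling interpolation. [folklore] -/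
theorem weightedDebyeGreen_decay :
    ∀ (d N k : ℕ) [NeZero N] (ε b₀ : ℝ), 0 ≤ ε → 0 < b₀ → ∀ (B : Fin k → Fin k → ℝ), (∀ w : Fin k → ℝ, b₀ * ∑ a : Fin k, w a ^ 2 ≤ ∑ a : Fin k, ∑ a' : Fin k, w a * B a a' * w a') → ∀ (wt : TorusSite d N → Fin d → ℝ), (∀ (x : TorusSite d N) (i : Fin d), 0 ≤ wt x i ∧ wt x i ≤ 1) → ∀ (y : TorusSite d N) (v : Fin k → ℝ) (u : TorusSite d N → Fin k → ℝ), (∀ (x : TorusSite d N) (a : Fin k), (ε + 2 * d) * u x a + ∑ a' : Fin k, B a a' * u x a' - ∑ i : Fin d, (wt x i * u (x + Pi.single i 1) a + wt (x - Pi.single i 1) i * u (x - Pi.single i 1) a) = if x = y then v a else 0) → ∀ (i₀ : Fin d) (n : ℕ) (x : TorusSite d N), (∀ z : ℤ, |z| < n → x i₀ - y i₀ ≠ (z : ZMod N)) → ∑ a : Fin k, u x a ^ 2 ≤ (∑ a : Fin k, v a ^ 2) / b₀ ^ 2 * ((2 * d / (2 * d + b₀)) ^ 2) ^ n := by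
  intro d N k _ ε b₀ hε hb₀ B hB wt hwt y v u hu i₀
  -- Step 0: the global `ℓ²` bound `Σ_x |u x|² ≤ |v|² / b₀²`, from `⟨u, (-Δ + ε) u⟩ ≥ 0` and `B ≥ b₀`
  have hglob : ∀ x : TorusSite d N, ∑ a : Fin k, u x a ^ 2 ≤ (∑ a : Fin k, v a ^ 2) / b₀ ^ 2 := by
    set U : ℝ := ∑ x : TorusSite d N, ∑ a : Fin k, u x a ^ 2 with hUdef
    -- pair the equation with `u`: coercivity on the left, the source on the right
    have hpair : ∑ x : TorusSite d N, ∑ a : Fin k, u x a *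
        ((ε + 2 * d) * u x a + ∑ a' : Fin k, B a a' * u x a' -
          ∑ i : Fin d, (wt x i * u (x + Pi.single i 1) a + wt (x - Pi.single i 1) i * u (x - Pi.single i 1) a)) =
        ∑ a : Fin k, u y a * v a := by
      rw [Finset.sum_congr rfl fun x _ => Finset.sum_congr rfl fun a _ => by rw [hu x a]]
      simp only [mul_ite, mul_zero]
      rw [Finset.sum_comm]
      refine Finset.sum_congr rfl fun a _ => ?_
      rw [Finset.sum_ite_eq' Finset.univ y, if_pos (Finset.mem_univ y)]
    have hkey : b₀ * U ≤ ∑ a : Fin k, u y a * v a := by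
      rw [← hpair, hUdef]
      exact weightedDebyeOp_coercive d N k ε b₀ hε B hB wt hwt u
    -- Cauchy–Schwarz: `(Σ_a u y a v a)² ≤ |u y|² |v|² ≤ U |v|²`
    have hCS : (∑ a : Fin k, u y a * v a) ^ 2 ≤ (∑ a : Fin k, u y a ^ 2) * ∑ a : Fin k, v a ^ 2 :=
      Finset.sum_mul_sq_le_sq_mul_sq _ _ _
    have hUy : ∑ a : Fin k, u y a ^ 2 ≤ U :=
      Finset.single_le_sum (f := fun x => ∑ a : Fin k, u x a ^ 2)
        (fun x _ => Finset.sum_nonneg fun a _ => sq_nonneg _) (Finset.mem_univ y)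
    have hU0 : 0 ≤ U := Finset.sum_nonneg fun x _ => Finset.sum_nonneg fun a _ => sq_nonneg _
    have hv0 : 0 ≤ ∑ a : Fin k, v a ^ 2 := Finset.sum_nonneg fun a _ => sq_nonneg _
    have hUle : U ≤ (∑ a : Fin k, v a ^ 2) / b₀ ^ 2 := by
      rw [le_div_iff₀ (by positivity)]
      -- `b₀² U² ≤ U |v|²`
      have h1 : (b₀ * U) ^ 2 ≤ U * ∑ a : Fin k, v a ^ 2 := by
        calc (b₀ * U) ^ 2 ≤ (∑ a : Fin k, u y a * v a) ^ 2 :=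
              pow_le_pow_left₀ (by positivity) hkey 2
          _ ≤ (∑ a : Fin k, u y a ^ 2) * ∑ a : Fin k, v a ^ 2 := hCS
          _ ≤ U * ∑ a : Fin k, v a ^ 2 := mul_le_mul_of_nonneg_right hUy hv0
      rcases hU0.lt_or_eq with hUpos | hU0'
      · have : b₀ ^ 2 * U ≤ ∑ a : Fin k, v a ^ 2 := by
          have h2 : (b₀ * U) ^ 2 = (b₀ ^ 2 * U) * U := by ring
          rw [h2] at h1
          exact le_of_mul_le_mul_right (by linarith) hUpos
        linarith
      · rw [← hU0']; simpa using hv0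
    intro x
    exact (Finset.single_le_sum (f := fun x => ∑ a : Fin k, u x a ^ 2)
      (fun x _ => Finset.sum_nonneg fun a _ => sq_nonneg _) (Finset.mem_univ x)).trans hUle
  -- Step n: induction on the separation
  intro n
  induction n with
  | zero => intro x _; simpa using hglob x
  | succ n ih =>
    intro x hfar
    have hxy : x ≠ y := by
      intro h
      refine hfar 0 (by simp) ?_
      rw [h, sub_self, Int.cast_zero]
    set M : ℝ := (∑ a : Fin k, v a ^ 2) / b₀ ^ 2 * ((2 * d / (2 * d + b₀)) ^ 2) ^ n with hMdef
    have hM0 : 0 ≤ M := by positivity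
    -- neighbours are `n`-far
    have hnb : ∀ (i : Fin d) (s : ℤ), (s = 1 ∨ s = -1) →
        ∀ z : ℤ, |z| < n → (x + Pi.single i (s : ZMod N) : TorusSite d N) i₀ - y i₀ ≠ (z : ZMod N) := by
      intro i s hs z hz h
      rw [Pi.add_apply] at h
      by_cases hi : i₀ = i
      · subst hi
        rw [Pi.single_eq_same] at h
        refine hfar (z - s) ?_ ?_
        · rcases hs with rfl | rfl <;>
          · rw [abs_lt] at hz ⊢; push_cast; constructor <;> linarith
        · rw [Int.cast_sub, ← h]; ring
      · rw [Pi.single_eq_of_ne hi, add_zero] at h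
        exact hfar z (lt_of_lt_of_le hz (by exact_mod_cast n.le_succ)) h
    have hplus : ∀ i : Fin d, ∑ a : Fin k, u (x + Pi.single i 1) a ^ 2 ≤ M := by
      intro i
      have := ih (x + Pi.single i ((1 : ℤ) : ZMod N)) (hnb i 1 (Or.inl rfl))
      simpa only [Int.cast_one] using this
    have hminus : ∀ i : Fin d, ∑ a : Fin k, u (x - Pi.single i 1) a ^ 2 ≤ M := by
      intro i
      have := ih (x + Pi.single i ((-1 : ℤ) : ZMod N)) (hnb i (-1) (Or.inr rfl))
      simpa only [Int.cast_neg, Int.cast_one, Pi.single_neg, ← sub_eq_add_neg] using this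
    -- the local equation at `x ≠ y`, paired with `u x`
    set S : ℝ := ∑ a : Fin k, u x a ^ 2 with hSdef
    set r : Fin k → ℝ := fun a => ∑ i : Fin d, (wt x i * u (x + Pi.single i 1) a + wt (x - Pi.single i 1) i * u (x - Pi.single i 1) a) with hrdef
    have hloc : (2 * d + b₀) * S ≤ ∑ a : Fin k, u x a * r a := by
      have h1 : ∀ a : Fin k, (ε + 2 * d) * u x a + ∑ a' : Fin k, B a a' * u x a' = r a := by
        intro a
        have := hu x a
        rw [if_neg hxy] at this
        linarith
      have h2 : ∑ a : Fin k, u x a * r a = (ε + 2 * d) * S + ∑ a : Fin k, ∑ a' : Fin k, u x a * B a a' * u x a' := by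
        rw [hSdef, Finset.mul_sum, ← Finset.sum_add_distrib]
        refine Finset.sum_congr rfl fun a _ => ?_
        rw [← h1 a, mul_add, Finset.mul_sum]
        congr 1
        · ring
        · exact Finset.sum_congr rfl fun a' _ => by ring
      have h3 := hB (u x)
      have hS0 : 0 ≤ S := Finset.sum_nonneg fun a _ => sq_nonneg _
      nlinarith
    -- `|r|² ≤ (2d)² M`
    have hr : ∑ a : Fin k, r a ^ 2 ≤ (2 * d) ^ 2 * M := by
      have h1 : ∀ a : Fin k, r a ^ 2 ≤ 2 * d * ∑ i : Fin d, (u (x + Pi.single i 1) a ^ 2 + u (x - Pi.single i 1) a ^ 2) := by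
        intro a
        calc r a ^ 2 ≤ (Finset.univ : Finset (Fin d)).card *
              ∑ i : Fin d, (wt x i * u (x + Pi.single i 1) a + wt (x - Pi.single i 1) i * u (x - Pi.single i 1) a) ^ 2 :=
              sq_sum_le_card_mul_sum_sq
          _ ≤ d * ∑ i : Fin d, 2 * (u (x + Pi.single i 1) a ^ 2 + u (x - Pi.single i 1) a ^ 2) := by
              rw [Finset.card_univ, Fintype.card_fin]
              refine mul_le_mul_of_nonneg_left (Finset.sum_le_sum fun i _ => ?_) (Nat.cast_nonneg d)
              obtain ⟨h0₁, h1₁⟩ := hwt x i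
              obtain ⟨h0₂, h1₂⟩ := hwt (x - Pi.single i 1) i
              have hA : (wt x i * u (x + Pi.single i 1) a + wt (x - Pi.single i 1) i * u (x - Pi.single i 1) a) ^ 2 ≤
                  2 * ((wt x i * u (x + Pi.single i 1) a) ^ 2 + (wt (x - Pi.single i 1) i * u (x - Pi.single i 1) a) ^ 2) := by
                nlinarith [sq_nonneg (wt x i * u (x + Pi.single i 1) a - wt (x - Pi.single i 1) i * u (x - Pi.single i 1) a)]
              have hB₁ : (wt x i * u (x + Pi.single i 1) a) ^ 2 ≤ u (x + Pi.single i 1) a ^ 2 := by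
                rw [mul_pow]
                exact mul_le_of_le_one_left (sq_nonneg _) (pow_le_one₀ h0₁ h1₁)
              have hB₂ : (wt (x - Pi.single i 1) i * u (x - Pi.single i 1) a) ^ 2 ≤ u (x - Pi.single i 1) a ^ 2 := by
                rw [mul_pow]
                exact mul_le_of_le_one_left (sq_nonneg _) (pow_le_one₀ h0₂ h1₂)
              linarith
          _ = 2 * d * ∑ i : Fin d, (u (x + Pi.single i 1) a ^ 2 + u (x - Pi.single i 1) a ^ 2) := by
              rw [← Finset.mul_sum]; ring
      calc ∑ a : Fin k, r a ^ 2
          ≤ ∑ a : Fin k, 2 * d * ∑ i : Fin d, (u (x + Pi.single i 1) a ^ 2 + u (x - Pi.single i 1) a ^ 2) :=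
            Finset.sum_le_sum fun a _ => h1 a
        _ = 2 * d * ∑ i : Fin d, (∑ a : Fin k, u (x + Pi.single i 1) a ^ 2 + ∑ a : Fin k, u (x - Pi.single i 1) a ^ 2) := by
            rw [← Finset.mul_sum, Finset.sum_comm]
            congr 1
            exact Finset.sum_congr rfl fun i _ => Finset.sum_add_distrib
        _ ≤ 2 * d * ∑ _i : Fin d, (M + M) :=
            mul_le_mul_of_nonneg_left (Finset.sum_le_sum fun i _ => add_le_add (hplus i) (hminus i)) (by positivity)
        _ = (2 * d) ^ 2 * M := by
            rw [Finset.sum_const, Finset.card_univ, Fintype.card_fin, nsmul_eq_mul]; ring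
    -- conclude: `(2d + b₀)² S ≤ |r|² ≤ (2d)² M`
    have hS0 : 0 ≤ S := Finset.sum_nonneg fun a _ => sq_nonneg _
    have hCS : (∑ a : Fin k, u x a * r a) ^ 2 ≤ S * ∑ a : Fin k, r a ^ 2 := Finset.sum_mul_sq_le_sq_mul_sq _ _ _
    have hD : 0 < 2 * (d : ℝ) + b₀ := by positivity
    have hfin : (2 * d + b₀) ^ 2 * S ≤ (2 * d) ^ 2 * M := by
      rcases hS0.lt_or_eq with hSpos | hS0'
      · have h1 : ((2 * d + b₀) * S) ^ 2 ≤ S * ((2 * d) ^ 2 * M) :=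
          calc ((2 * d + b₀) * S) ^ 2 ≤ (∑ a : Fin k, u x a * r a) ^ 2 :=
                pow_le_pow_left₀ (by positivity) hloc 2
            _ ≤ S * ∑ a : Fin k, r a ^ 2 := hCS
            _ ≤ S * ((2 * d) ^ 2 * M) := mul_le_mul_of_nonneg_left hr hS0
        have h2 : ((2 * d + b₀) * S) ^ 2 = ((2 * d + b₀) ^ 2 * S) * S := by ring
        rw [h2, mul_comm S] at h1
        exact le_of_mul_le_mul_right h1 hSpos
      · rw [← hS0', mul_zero]; positivity
    have hρ : (2 * d) ^ 2 * M / (2 * d + b₀) ^ 2 = M * (2 * d / (2 * d + b₀)) ^ 2 := by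
      rw [div_pow]; ring
    calc S ≤ (2 * d) ^ 2 * M / (2 * d + b₀) ^ 2 := by
          rw [le_div_iff₀ (by positivity)]; linarith
      _ = M * (2 * d / (2 * d + b₀)) ^ 2 := hρ
      _ = (∑ a : Fin k, v a ^ 2) / b₀ ^ 2 * ((2 * d / (2 * d + b₀)) ^ 2) ^ (n + 1) := by
          rw [hMdef, pow_succ]; ring

end Summit.QuantumFields.YangMills.Theorems.AnchorGap

end
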